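import Summits.CriticalPhenomena.PercolationContinuityZ3.Theorems.PercNearOneGluingNoHeavyLowerTailThreePartitionCombBridgeConverse
import Summits.CriticalPhenomena.PercolationContinuityZ3.Theorems.SahiMasterFamily

/-!
# Zero-flag triples have ALL three-partition counts zero (unit `prim-master-conj`, gen 33; `--supports stmt-CriticalPhenomena-4575`)

For up-sets `U, V, W ⊆ 𝒫(ι)` the twisted three-partition counts `threePartNT τ U V W` of `…ThreePartitionADTwisted` are the
degree-3 tensor-Bernstein coefficients of `p ↦ E₃(μ_p; 1_U, 1_V, 1_W)` (`combCoef3_eq_threePartNT`, `…ThreePartitionCombBridge`).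
If `(U,V,W)` lies in the zero-flag class `Z₃` (`SuppZeroFlag 3 ![U,V,W]`, `SahiMasterFamily`), then `E₃ ≡ 0` on the whole cube
(`sahiE_ind_eq_zero_of_suppZeroFlag`), so by uniqueness of tensor-Bernstein coefficients (`bern_coeff_unique`) every fibre sum
`combCoef3 U V W j` vanishes, and hence `threePartNT τ U V W = 0` for every twist `τ` (no monotonicity needed).

This is the "easy" direction of the following census observation (this session, exhaustive over all `790 244` unordered
triples of non-empty up-sets of `2^[4]` and all of `2^[3]`; kit job `j202586` for `m = 5` samples): the UNTWISTED count
`threePartN U V W` vanishes ONLY on `Z₃` — every zero of the all-singly-active coefficient is a zero-flag triple — whereas the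
twisted counts (`τ ≠ ∅`) have additional zeros.  We record the converse as a remark only (no conjecture is asserted here).
No `sorry`; standard axioms. [this work]
-/

open scoped Classical
open Finset

namespace Summit.CriticalPhenomena.PercolationContinuityZ3.Theorems.ThreePartition

open Literature.Combinatorics.Sahi2008
open Literature.Probability.Percolation.DecisionTree (ind)
open SahiComb

variable {ι : Type} [Fintype ι]

/-- **Every tensor-Bernstein coefficient of `E₃` vanishes on a zero-flag triple**: `SuppZeroFlag 3 ![U,V,W] → combCoef3 U V W j = 0`
for every profile `j` (from `E₃ ≡ 0` and uniqueness of Bernstein coefficients). [this work] -/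
theorem combCoef3_eq_zero_of_suppZeroFlag {U V W : Set (Set ι)} (hZ : SuppZeroFlag 3 ![U, V, W]) (j : ι → ℕ) :
    combCoef3 U V W j = 0 := by
  by_cases hj : j ∈ box (fun _ : ι => 3)
  · have hfun : (fun k => ind ((![U, V, W] : Fin 3 → Set (Set ι)) k)) = ![ind U, ind V, ind W] := by
      funext k; fin_cases k <;> rfl
    have h0 : ∀ p : ι → unitInterval, sahiE (bernoulliWeight p) 3 ![ind U, ind V, ind W] = 0 := fun p => by
      rw [← hfun]; exact sahiE_ind_eq_zero_of_suppZeroFlag p hZ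
    have hu := bern_coeff_unique (c := fun _ : ι => 3) (N := combCoef3 U V W) (N' := fun _ => 0)
      (fun p => by
        rw [← sahiE_three_ind_bernstein, h0 p]
        simp only [zero_mul, sum_const_zero]) hj
    exact hu
  · rw [mem_box] at hj
    exact combCoef3_eq_zero_of_not_le U V W hj

/-- **Zero-flag triples have all twisted three-partition counts equal to zero**: `SuppZeroFlag 3 ![U,V,W] →
threePartNT τ U V W = 0` for every twist `τ` (take the all-active profile `j = 1 + 1_τ` and transport along `Act j ≃ ι`, exactly
as in `threePartNT_nonneg_of_combPos`).  The census converse "`threePartN U V W = 0 → Z₃`" (untwisted count only) is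
observed exhaustively on `2^[3]`, `2^[4]` and is NOT claimed here. [this work] -/
theorem threePartNT_eq_zero_of_suppZeroFlag (τ : Set ι) {U V W : Set (Set ι)} (hZ : SuppZeroFlag 3 ![U, V, W]) :
    threePartNT τ U V W = 0 := by
  let j : ι → ℕ := fun e => if e ∈ τ then 2 else 1
  have hj3 : ∀ e, j e ≤ 3 := fun e => by dsimp only [j]; split_ifs <;> omega
  have hjne : ∀ e, j e ≠ 3 := fun e => by dsimp only [j]; split_ifs <;> omega
  have hact : ∀ e, j e = 1 ∨ j e = 2 := fun e => by dsimp only [j]; split_ifs <;> omega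
  let φ : Act j ≃ ι := Equiv.subtypeUnivEquiv hact
  have hφ : ∀ T : Set (Act j), φ '' T = Subtype.val '' T := fun T => rfl
  have h0 := combCoef3_eq_zero_of_suppZeroFlag hZ j
  rw [combCoef3_eq_threePartNT U V W hj3] at h0
  have h1 : threePartNT (twist j) (secFam j U) (secFam j V) (secFam j W) = (0 : ℤ) := by exact_mod_cast h0
  have hτ : twist j = φ ⁻¹' τ := by
    ext e
    simp only [twist, Set.mem_setOf_eq, Set.mem_preimage, φ, Equiv.subtypeUnivEquiv_apply]
    dsimp only [j]
    split_ifs with he <;> simp [he]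
  have hsec : ∀ X : Set (Set ι), secFam j X = comapFam φ X := fun X => by
    ext T
    simp only [secFam, comapFam, Set.mem_setOf_eq, liftSet_eq_image hjne, hφ]
  rw [hτ, hsec, hsec, hsec, threePartNT_comap_equiv] at h1
  exact h1

/-- The untwisted case: `SuppZeroFlag 3 ![U,V,W] → threePartN U V W = 0`. [this work] -/
theorem threePartN_eq_zero_of_suppZeroFlag {U V W : Set (Set ι)} (hZ : SuppZeroFlag 3 ![U, V, W]) :
    threePartN U V W = 0 := by
  rw [← threePartNT_empty]
  exact threePartNT_eq_zero_of_suppZeroFlag ∅ hZ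

end Summit.CriticalPhenomena.PercolationContinuityZ3.Theorems.ThreePartition
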